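import Summits.QuantumFields.YangMills.Theses.BalabanFamilyExport
import HarnessLib

/-!
# Route item `FamilyCeilingsGlue` of `BalabanFamilyExport` (line `regime_split` on the crux `UVSeamRec`, stmt-QuantumFields-20043)

Support item stmt-QuantumFields-25865 of the draft export route `BalabanFamilyExport`:
`ApexFamilyCeilings → UniformFamilyCeilings → FamilyCeilings` — a pure case split of each class torus `M = 2·Lⁿ` on its
physical size (the uniform child yields `L`, `ℓ_f` and constants for class tori with `M·uRec β ≥ ℓ_f`; the apex child at
`(L, ℓ_f)` covers the femto class tori `M·uRec β ≤ ℓ_f`; monotonicity of `(C/R⁴)ⁿ` in `C` closes both cases).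

The proof is the ideator's kernel-checked glue (ym-idea-9, `Cruxes/UVSeamRec/Lines/regime_split.lean`,
`familyCeilings_of_regimeSplit`), landed under `Theorems/` so that the route item is closed by name.  Bookkeeping only: no
ceiling, seam, floor, E0′, NT or gap statement is proved; YM mass gap NOT proved.
-/

set_option autoImplicit false

namespace Summit.QuantumFields.YangMills.Cruxes.UVSeamRec.ExportGlue

open Summit.QuantumFields.YangMills.Theses.BalabanFamilyExport

/-- **Route item `FamilyCeilingsGlue` (stmt-QuantumFields-25865)**: `ApexFamilyCeilings → UniformFamilyCeilings → FamilyCeilings`,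
by the case split of each class torus `M = 2·Lⁿ` on its physical size `M·uRec β ≤ ℓ_f` (apex child) or `≥ ℓ_f` (uniform child),
with constants `(max C₁ C₂, max β₁ β₂, min ℓ₁ ℓ₂)`. -/
theorem familyCeilingsGlue_proof : FamilyCeilingsGlue := by
  intro hA hU
  obtain ⟨L, hLodd, hL, ℓf, hℓf, C₁, β₁, ℓ₁, hℓ₁, hC₁, h₁⟩ := hU
  obtain ⟨C₂, β₂, ℓ₂, hℓ₂, hC₂, h₂⟩ := hA L hLodd hL ℓf hℓf
  refine ⟨L, hLodd, hL, max C₁ C₂, max β₁ β₂, min ℓ₁ ℓ₂, lt_min hℓ₁ hℓ₂, le_max_of_le_left hC₁, ?_⟩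
  intro β hβ M _ hM n q x R hq hR hRu hRM hsep
  have hR4 : (0 : ℝ) < (R : ℝ) ^ 4 := by positivity
  by_cases hsz : (M : ℝ) * Summit.QuantumFields.YangMills.Cruxes.UVSeamRec.Transport.uRec β ≤ ℓf
  · have := h₂ β (le_trans (le_max_right _ _) hβ) M hM n q x R hq hR (le_trans hRu (min_le_right _ _)) hRM hsz hsep
    refine le_trans this (pow_le_pow_left₀ (div_nonneg hC₂ hR4.le) ?_ n)
    exact div_le_div_of_nonneg_right (le_max_right _ _) hR4.le
  · have hge : ℓf ≤ (M : ℝ) * Summit.QuantumFields.YangMills.Cruxes.UVSeamRec.Transport.uRec β :=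
      le_of_lt (lt_of_not_ge hsz)
    have := h₁ β (le_trans (le_max_left _ _) hβ) M hM n q x R hq hR (le_trans hRu (min_le_left _ _)) hRM hge hsep
    refine le_trans this (pow_le_pow_left₀ (div_nonneg hC₁ hR4.le) ?_ n)
    exact div_le_div_of_nonneg_right (le_max_left _ _) hR4.le

end Summit.QuantumFields.YangMills.Cruxes.UVSeamRec.ExportGlue
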